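import Summits.QuantumFields.BalabanUV.Gaps.EndTopRunCriterion

/-!
# Gaps / EndTopRunCrossingWitness — the non-crossing hypothesis of `EndTopRunCriterion.reachable_iff_topRuns` is NEEDED: a CROSSING toy flow,
# continuous and bounded above, all of whose small targets are reached at every length while one of its runs rises to the top of the interval
# and then falls below every threshold
# (cell pub-balaban-gaps, seat g1-p3 gen 6, row CAP+tail ∕ β-currency «split ∕ weakening»; definition-lane companion of `Gaps/EndTopRunCriterion`)

HONEST FRAMING (cell rule, page 1 of everything): an explicit [folklore] toy family of history-dependent β-functions (depending on the bare
coupling `g_0` only) and elementary real analysis on it; statements about the TOY, not about Bałaban's β; [I] Thm 2 unproved in print;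
NOTHING of Bałaban's is asserted; 0∕6 binders; 0 coefficients certified; one finite T⁴; NOT B12 Thm 2, NOT `BetaPertH`, NOT continuum, NOT Clay.

THE FAMILY (level `γ = 1`, bad start `a = 1∕2`).  `ramp x = max 0 (min 1 (4x − 1))` (`= 0` for `x ≤ 1∕4`, `= 1` for `x ≥ 1∕2`);
`betaX 0 v = 1 + 2·ramp v_0`, `betaX (k+1) v = 1 − 2·ramp v_0`: on histories starting at `g_0 ≤ 1∕4` the family is `≡ 1` (asymptotic freedom,
all small targets reached: `reachable_betaX`), on histories starting at `g_0 ≥ 1∕2` it is `3` at the first step and `−1` ever after — the run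
from `1∕2` RISES TO `g_1 = 1` (the top of the level-1 interval) and then FALLS as `g_k = 1∕√k` below every threshold (`badRun`), CROSSING the
rising runs.  So at level 1: the left side of `EndTopRunCriterion.reachable_iff_topRuns` holds with `g⋆ = 1∕4` (`reachable_betaX`) while its
right side fails for every `g⋆ > 0` (`not_topRuns_betaX`) — the equivalence FAILS without non-crossing (`iff_fails_without_nonCrossing`), though
`betaX` is jointly continuous (`betaX_cont`) and `≤ 3` (`betaX_upper`).  What this does NOT show: a failure of the construction-level criterion
`endpointExistence_iff_topRuns` without non-crossing (at levels `γ ≤ 1∕4` this family is order-preserving and both sides hold); nothing about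
Bałaban's β.  3 def (toy data `ramp`, `betaX`, `badRun`); 0 sorry; imports `Gaps/EndTopRunCriterion` only.

CITATION HEADER (tags CONTEXT ONLY).  [I] = T. Bałaban, Commun. Math. Phys. **109** (1987) [Balaban1987RG1]: (0.20) p. 256, §5 p. 298.
-/

namespace Summit.QuantumFields.BalabanUV.Gaps.EndTopRunCrossingWitness

open Literature.MathematicalPhysics.QuantumFieldTheory.Balaban1983to89
open Literature.MathematicalPhysics.QuantumFieldTheory.Balaban1983to89.FlowStep
open Literature.MathematicalPhysics.QuantumFieldTheory.Balaban1983to89.FlowStepRuns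
open Literature.MathematicalPhysics.QuantumFieldTheory.Balaban1983to89.DagBinding
open Summit.QuantumFields.BalabanUV.Gaps.EndRunwiseShooting
open Summit.QuantumFields.BalabanUV.Gaps.EndTopRunCriterion
open Finset

noncomputable section

/-! ## §1 The family -/

/-- The ramp `max 0 (min 1 (4x − 1))`: `0` on `]−∞, 1∕4]`, `1` on `[1∕2, ∞[`, continuous. [folklore] -/
def ramp (x : ℝ) : ℝ := max 0 (min 1 (4 * x - 1))

/-- THE CROSSING FAMILY: `β_1(v) = 1 + 2·ramp(v_0)`, `β_{k+2}(v) = 1 − 2·ramp(v_0)` — a function of the bare coupling `v_0` only. [folklore] -/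
def betaX : HBeta := fun k v => if k = 0 then 1 + 2 * ramp (v 0) else 1 - 2 * ramp (v 0)

/-- THE BAD RUN from `g_0 = 1∕2`: `g_0 = 1∕2`, `g_k = 1∕√k` for `k ≥ 1` (rises to `1`, then falls below every threshold). [folklore] -/
def badRun : ℕ → ℝ := fun k => if k = 0 then 1 / 2 else 1 / Real.sqrt k

/-- `ramp = 0` below `1∕4`. [folklore] -/
theorem ramp_eq_zero {x : ℝ} (hx : x ≤ 1 / 4) : ramp x = 0 := by
  unfold ramp
  exact max_eq_left (min_le_of_right_le (by linarith))

/-- `ramp = 1` above `1∕2`. [folklore] -/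
theorem ramp_eq_one {x : ℝ} (hx : 1 / 2 ≤ x) : ramp x = 1 := by
  unfold ramp
  rw [min_eq_left (by linarith : (1 : ℝ) ≤ 4 * x - 1)]
  exact max_eq_right zero_le_one

/-- `0 ≤ ramp ≤ 1`. [folklore] -/
theorem ramp_mem (x : ℝ) : 0 ≤ ramp x ∧ ramp x ≤ 1 :=
  ⟨le_max_left _ _, max_le zero_le_one (min_le_left _ _)⟩

/-- `ramp` is continuous. [folklore] -/
theorem continuous_ramp : Continuous ramp :=
  continuous_const.max (continuous_const.min ((continuous_const.mul continuous_id).sub continuous_const))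

/-- `betaX ≤ 3` on every box. [folklore] -/
theorem betaX_upper (γ : ℝ) : BetaUpperH 3 γ betaX := by
  intro k v _
  unfold betaX
  have h := ramp_mem (v 0)
  split_ifs <;> linarith [h.1, h.2]

/-- `betaX` is jointly continuous on every box (it is continuous on the whole space). [folklore] -/
theorem betaX_cont (γ : ℝ) : BetaContH γ betaX := by
  intro k
  unfold betaX
  have hc : Continuous fun v : Fin (k + 1) → ℝ => ramp (v 0) := continuous_ramp.comp (continuous_apply 0)
  split_ifs
  · exact (continuous_const.add (continuous_const.mul hc)).continuousOn
  · exact (continuous_const.sub (continuous_const.mul hc)).continuousOn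

/-- On histories starting at `g_0 ≤ 1∕4` the family is `≡ 1`. [folklore] -/
theorem betaX_eq_one_of_small {k : ℕ} {v : Fin (k + 1) → ℝ} (hv : v 0 ≤ 1 / 4) : betaX k v = 1 := by
  unfold betaX; rw [ramp_eq_zero hv]; split_ifs <;> ring

/-- On histories starting at `g_0 ≥ 1∕2`: `β_1 = 3`, `β_{k+2} = −1`. [folklore] -/
theorem betaX_of_large {k : ℕ} {v : Fin (k + 1) → ℝ} (hv : 1 / 2 ≤ v 0) :
    betaX k v = if k = 0 then 3 else -1 := by
  unfold betaX; rw [ramp_eq_one hv]; split_ifs <;> norm_num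

/-! ## §2 The good runs: every target `g ≤ 1∕4` is reached at every length, inside `]0,1]` -/

/-- The asymptotically free runs `g_k = (1∕g² + K − k)^{−1∕2}` from a bare coupling `≤ g ≤ 1∕4` reach `g` at time `K` inside `]0, g] ⊆ ]0,1]`,
solving (0.20) for `betaX` (which is `≡ 1` along them). [folklore] -/
theorem reachable_betaX : ∀ (K : ℕ) (g : ℝ), 0 < g → g ≤ 1 / 4 →
    ∃ gs : ℕ → ℝ, gs K = g ∧ RGEqH K betaX gs ∧ Step.InInterval 1 K gs := by
  intro K g hg hg4
  set gs : ℕ → ℝ := fun k => 1 / Real.sqrt (1 / g ^ 2 + ((K : ℝ) - k)) with hgs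
  have hrad : ∀ k, k ≤ K → 0 < 1 / g ^ 2 + ((K : ℝ) - k) := by
    intro k hk
    have : (k : ℝ) ≤ K := by exact_mod_cast hk
    have : 0 < 1 / g ^ 2 := by positivity
    linarith
  have hsq : ∀ k, k ≤ K → 1 / (gs k) ^ 2 = 1 / g ^ 2 + ((K : ℝ) - k) := by
    intro k hk
    rw [hgs]; dsimp only
    rw [div_pow, one_pow, Real.sq_sqrt (hrad k hk).le, one_div_one_div]
  have hpos : ∀ k, k ≤ K → 0 < gs k := fun k hk => by
    rw [hgs]; dsimp only; exact div_pos one_pos (Real.sqrt_pos.mpr (hrad k hk))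
  have hle_g : ∀ k, k ≤ K → gs k ≤ g := by
    intro k hk
    have h1 : 1 / g ^ 2 ≤ 1 / (gs k) ^ 2 := by
      rw [hsq k hk]; have : (k : ℝ) ≤ K := by exact_mod_cast hk
      linarith
    have h2 : (gs k) ^ 2 ≤ g ^ 2 := by rwa [one_div_le_one_div (by positivity) (pow_pos (hpos k hk) 2)] at h1
    nlinarith [hpos k hk, hg]
  have hK : gs K = g := by
    have h1 : 1 / (gs K) ^ 2 = 1 / g ^ 2 := by rw [hsq K le_rfl]; simp
    have h2 : (gs K) ^ 2 = g ^ 2 := by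
      have := congrArg (fun t : ℝ => 1 / t) h1; simpa only [one_div_one_div] using this
    nlinarith [hpos K le_rfl, hg]
  refine ⟨gs, hK, fun k hk => ?_, fun k hk => ⟨hpos k hk, (hle_g k hk).trans (by linarith)⟩⟩
  -- (0.20): `1∕g_k² = 1∕g_{k+1}² + β_k`, `β_k = 1` since `g_0 ≤ 1∕4`
  have h0 : prefixOf gs k 0 ≤ 1 / 4 := by
    show gs ((0 : Fin (k + 1)) : ℕ) ≤ 1 / 4
    exact (hle_g 0 (Nat.zero_le K)).trans hg4
  rw [betaX_eq_one_of_small h0, hsq k hk.le, hsq (k + 1) hk]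
  push_cast; ring

/-! ## §3 The bad run: in `]0,1]`, solves (0.20), sits at the top at step `1`, ends below every threshold -/

/-- Values of the bad run. [folklore] -/
theorem badRun_zero : badRun 0 = 1 / 2 := by simp [badRun]

/-- `g_k = 1∕√k` for `k ≥ 1`. [folklore] -/
theorem badRun_succ (k : ℕ) : badRun (k + 1) = 1 / Real.sqrt ((k : ℝ) + 1) := by
  simp [badRun, Nat.cast_add, Nat.cast_one]

/-- `1∕g_{k}² = k` for `k ≥ 1`. [folklore] -/
theorem inv_sq_badRun_succ (k : ℕ) : 1 / (badRun (k + 1)) ^ 2 = (k : ℝ) + 1 := by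
  rw [badRun_succ, div_pow, one_pow, Real.sq_sqrt (by positivity), one_div_one_div]

/-- The bad run sits at the top `g_1 = 1`. [folklore] -/
theorem badRun_one : badRun 1 = 1 := by
  rw [show (1 : ℕ) = 0 + 1 from rfl, badRun_succ]; simp

/-- The bad run lies in `]0,1]` for ever. [folklore] -/
theorem badRun_inInterval (n : ℕ) : Step.InInterval 1 n badRun := by
  intro k _
  rcases k with _ | k
  · rw [badRun_zero]; norm_num
  · rw [badRun_succ]
    have hs : 1 ≤ Real.sqrt ((k : ℝ) + 1) := by
      have h := Real.sqrt_le_sqrt (show (1 : ℝ) ≤ (k : ℝ) + 1 by have : (0 : ℝ) ≤ k := Nat.cast_nonneg k; linarith)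
      rwa [Real.sqrt_one] at h
    exact ⟨by positivity, (div_le_one (by positivity)).mpr hs⟩

/-- The bad run solves (0.20) for `betaX` at every horizon: step `0` with `β_1 = 3` (`4 = 1 + 3`), later steps with `β = −1` (`k = (k+1) − 1`).
[folklore] -/
theorem badRun_rgEqH (n : ℕ) : RGEqH n betaX badRun := by
  intro k _
  have h0 : 1 / 2 ≤ prefixOf badRun k 0 := by
    show 1 / 2 ≤ badRun ((0 : Fin (k + 1)) : ℕ)
    rw [Fin.val_zero, badRun_zero]
  rw [betaX_of_large h0]
  rcases k with _ | k
  · rw [if_pos rfl, badRun_zero, show (0 : ℕ) + 1 = 0 + 1 from rfl, inv_sq_badRun_succ]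
    norm_num
  · rw [if_neg (Nat.succ_ne_zero k), inv_sq_badRun_succ, show k + 1 + 1 = (k + 1) + 1 from rfl, inv_sq_badRun_succ]
    push_cast; ring

/-- … and ends below every threshold: `g_{n} < g⋆` for `n = ⌈1∕g⋆²⌉₊ + 2`. [folklore] -/
theorem badRun_small {gstar : ℝ} (hg : 0 < gstar) : ∃ n : ℕ, 2 ≤ n ∧ badRun n < gstar := by
  refine ⟨⌈1 / gstar ^ 2⌉₊ + 2, by omega, ?_⟩
  rw [show ⌈1 / gstar ^ 2⌉₊ + 2 = (⌈1 / gstar ^ 2⌉₊ + 1) + 1 from rfl, badRun_succ]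
  have hc : 1 / gstar ^ 2 ≤ (⌈1 / gstar ^ 2⌉₊ : ℝ) := Nat.le_ceil _
  have hrad : 1 / gstar ^ 2 < ((⌈1 / gstar ^ 2⌉₊ + 1 : ℕ) : ℝ) + 1 := by push_cast; linarith
  have hpos : 0 < ((⌈1 / gstar ^ 2⌉₊ + 1 : ℕ) : ℝ) + 1 := by positivity
  rw [div_lt_iff₀ (Real.sqrt_pos.mpr hpos)]
  -- `1 < g⋆ · √(N+1)` since `1∕g⋆² < N + 1`
  have h1 : 1 / gstar < Real.sqrt (((⌈1 / gstar ^ 2⌉₊ + 1 : ℕ) : ℝ) + 1) := by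
    rw [show 1 / gstar = Real.sqrt ((1 / gstar) ^ 2) by rw [Real.sqrt_sq (by positivity)]]
    exact Real.sqrt_lt_sqrt (by positivity) (by rw [div_pow, one_pow]; exact hrad)
  have := (div_lt_iff₀' hg).mp h1
  linarith

/-! ## §4 The failure of the one-level criterion without non-crossing -/

/-- AT LEVEL `1` THE TOP-RUN CONDITION FAILS FOR EVERY THRESHOLD: for every `g⋆ > 0` some in-interval solution of (0.20) (the bad run) sits at
`γ = 1` at step `1` and ends below `g⋆`. [folklore] -/
theorem not_topRuns_betaX {gstar : ℝ} (hg : 0 < gstar) :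
    ¬ (∀ (n : ℕ) (gs : ℕ → ℝ), RGEqH n betaX gs → Step.InInterval 1 n gs → ∀ k, k ≤ n → gs k = 1 → gstar ≤ gs n) := by
  intro h
  obtain ⟨n, hn, hlt⟩ := badRun_small hg
  have := h n badRun (badRun_rgEqH n) (badRun_inInterval n) 1 (by omega) badRun_one
  linarith

/-- **THE ONE-LEVEL CRITERION FAILS WITHOUT NON-CROSSING.**  For the continuous, bounded-above family `betaX` at level `γ = 1` with `g⋆ = 1∕4`:
the LEFT side of `EndTopRunCriterion.reachable_iff_topRuns` holds (every `g ∈ ]0,1∕4]` is the endpoint of an in-interval solution of (0.20) of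
every length) while its RIGHT side fails (a solution sitting at the top ends below `1∕4`) — so the iff is false for this (crossing) flow, and the
hypothesis `hord` of that theorem cannot be dropped.  In particular the runs of `betaX` DO cross (else the theorem would apply). [folklore] -/
theorem iff_fails_without_nonCrossing :
    BetaContH 1 betaX ∧ BetaUpperH 3 1 betaX ∧
    (∀ (K : ℕ) (g : ℝ), 0 < g → g ≤ 1 / 4 → ∃ gs : ℕ → ℝ, gs K = g ∧ RGEqH K betaX gs ∧ Step.InInterval 1 K gs) ∧
    ¬ (∀ (n : ℕ) (gs : ℕ → ℝ), RGEqH n betaX gs → Step.InInterval 1 n gs → ∀ k, k ≤ n → gs k = 1 → (1 / 4 : ℝ) ≤ gs n) :=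
  ⟨betaX_cont 1, betaX_upper 1, reachable_betaX, not_topRuns_betaX (by norm_num)⟩

/-- Consequently the in-interval runs of `betaX` at level `1` CROSS: strict order preservation fails (by `reachable_iff_topRuns` read
contrapositively). [folklore] -/
theorem runs_cross :
    ¬ (∀ (n : ℕ) (gs gs' : ℕ → ℝ), RGEqH n betaX gs → RGEqH n betaX gs' → Step.InInterval 1 n gs → Step.InInterval 1 n gs' →
      gs 0 < gs' 0 → ∀ k, k ≤ n → gs k < gs' k) := by
  intro hord
  have h := (reachable_iff_topRuns one_pos (by norm_num : (0 : ℝ) ≤ 3) (betaX_cont 1) (betaX_upper 1) hord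
    (by norm_num : (0 : ℝ) < 1 / 4) (by norm_num)).1 reachable_betaX
  exact not_topRuns_betaX (by norm_num) h

end

end Summit.QuantumFields.BalabanUV.Gaps.EndTopRunCrossingWitness
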